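import Summits.QuantumAdvantage.QuantumAdvantage.Theorems.CubicForrelationNearExactIsExactMinWeightFlat
import Summits.QuantumAdvantage.QuantumAdvantage.Theorems.CubicForrelationNearExactIsExactQuadBalancedStructure
import Summits.QuantumAdvantage.QuantumAdvantage.Theorems.CubicForrelationNearExactIsExactInvariantWeight

/-!
# Crux `CubicForrelation.NearExactIsExact` (stmt-QuantumAdvantage-14043) — brick: the SECOND weight of `RM(2,m)` and of `RM(3,m)`
  (no quadratic weight strictly between `2^{m-2}` and `3·2^{m-3}`; no cubic weight strictly between `2^{m-3}` and `3·2^{m-4}`)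

Certificate seat `b2b-cforr-cert` (gen 12).  HONEST FRAMING: an elementary coding-theory BRICK (uniform in `m`, standard axioms),
formalising a classical fact (Kasami–Tokura 1970; Berlekamp–Sloane 1969: the weights of `RM(r,m)` in `(d, 2d)` are `2d − 2^i`, in
particular nothing lies in `(d, 3d/2)`), for `r = 2, 3` only.  It is the tool that turns a budget inequality `#E < 3·2^{m-4}` on the
support `E` of a non-zero cubic into `#E = 2^{m-3}` (hence, by `mw_flat_of_minweight`, `E` is a flat) — used by the `n = 12`
window analysis `…TwelveTypeOWindow.lean`.  NOT summit progress.

Proof (derivative counting, the method of `mw_flat_of_minweight` one weight up).  For `e : 𝔽₂^m → 𝔽₂` with support `S` and a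
direction `a`, the derivative `D_a e = e ⊕ e(· ⊕ a)` has weight `δ(a) ≤ 2·#S` (`sw_deriv_card_le`) and `Σ_a δ(a) = 2·#S·(2^m − #S)`
(`sw_sum_deriv_card`); the periods `V₀ = {a : δ(a) = 0}` are an xor-closed set containing `0`, so `#V₀ = 2^j` (`sw_card_xorClosed`,
via `stub_invariantWeight`).  If every non-zero `δ(a)` equals one constant `K` then `2·#S·(2^m − #S) = K·(2^m − 2^j)` (`sw_master`).
* `r = 2` (`sw_quadratic_second_weight`): `D_a q` is affine, hence `0`, balanced or `≡ 1` (`qb_affine_dichotomy`); `≡ 1` is excluded by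
  `δ ≤ 2#S < 2^m`, so `K = 2^{m-1}` and `(2^m − 2#S)² = 2^{m+j}`: `2^m − 2#S` is a power of two in `(2^{m-2}, 2^m]`, i.e. `#S ∈ {0, 2^{m-2}}`.
* `r = 3` (`sw_cubic_second_weight`): `D_a c` is quadratic of weight `≤ 2#S < 3·2^{m-3}`, so by the `r = 2` case `δ(a) ∈ {0, 2^{m-2}}`,
  `K = 2^{m-2}` and `(2^{m+1} − 4#S)² = 2^{m+1}(2^m + 2^j) = 2^{m+1+j}(2^{m-j} + 1)`: the odd part `2^{m-j} + 1` must be a perfect square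
  (`sw_odd_part_sq`), which forces `m − j = 3` (`sw_sq_eq_two_pow_add_one`: `(b−1)(b+1) = 2^d` only for `b = 3`), and then `8·#S = 2^m`.

References: T. Kasami, N. Tokura, *On the weight structure of Reed–Muller codes*, IEEE Trans. Inform. Theory 16 (1970) 752–759;
E. R. Berlekamp, N. J. A. Sloane, *Restrictions on weight distribution of Reed–Muller codes*, Inform. Control 14 (1969) 442–456;
F. J. MacWilliams, N. J. A. Sloane, *The Theory of Error-Correcting Codes* (1977) Ch. 13 §4, Ch. 15 §3.  Everything below is proved from
Mathlib and the tree; axioms are the standard three.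
-/

set_option linter.dupNamespace false -- D-0017: single-problem summit ⇒ `QuantumAdvantage.QuantumAdvantage` by design

noncomputable section

namespace Summit.QuantumAdvantage.QuantumAdvantage.Theorems.CubicForrelation.NearExactIsExact

open Finset
open Literature.Computability.QuantumComplexity
open Literature.Computability.QuantumComplexity.BuzetChailloux (bxor zeroVec bxor_bxor_cancel_left bxor_zeroVec zeroVec_bxor)

variable {m : ℕ}

/-! ### Arithmetic: perfect squares of the form `2^e · odd` and `2^d + 1` -/

/-- Powers of two differing by `2` are `2` and `4`: `2^q = 2^p + 2 ⇒ p = 1 ∧ q = 2`. [folklore] -/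
theorem sw_two_pow_eq_two_pow_add_two {p q : ℕ} (h : 2 ^ q = 2 ^ p + 2) : p = 1 ∧ q = 2 := by
  have hpq : p < q := (Nat.pow_lt_pow_iff_right (by norm_num : 1 < 2)).1 (by omega)
  rcases Nat.eq_zero_or_pos p with rfl | hp
  · -- `2^q = 3`
    exfalso
    rcases Nat.lt_or_ge q 2 with hq | hq
    · interval_cases q
      all_goals simp at h
    · have : 2 ^ 2 ≤ 2 ^ q := Nat.pow_le_pow_right (by norm_num) hq
      omega
  · have hdvd : 2 ^ p ∣ 2 := by
      have h1 : 2 ^ p ∣ 2 ^ q := pow_dvd_pow 2 hpq.le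
      rw [h] at h1
      exact (Nat.dvd_add_right dvd_rfl).1 h1
    have hp1 : p ≤ 1 := by
      have := Nat.le_of_dvd (by norm_num) hdvd
      rcases Nat.lt_or_ge p 2 with hp2 | hp2
      · omega
      · have : 2 ^ 2 ≤ 2 ^ p := Nat.pow_le_pow_right (by norm_num) hp2
        omega
    have hp' : p = 1 := by omega
    subst hp'
    refine ⟨rfl, ?_⟩
    have h4 : 2 ^ q = 2 ^ 2 := by rw [h]; norm_num
    exact Nat.pow_right_injective (le_refl 2) h4

/-- `2^d + 1` is a perfect square only for `d = 3` (`(b−1)(b+1) = 2^d`). [folklore] -/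
theorem sw_sq_eq_two_pow_add_one {b d : ℕ} (h : b * b = 2 ^ d + 1) : d = 3 := by
  have hb2 : 2 ≤ b := by
    by_contra hb
    push Not at hb
    have h1 : 1 ≤ 2 ^ d := Nat.one_le_two_pow
    interval_cases b <;> omega
  have hfac : (b - 1) * (b + 1) = 2 ^ d := by
    obtain ⟨c, rfl⟩ : ∃ c, b = c + 1 := ⟨b - 1, by omega⟩
    rw [Nat.add_sub_cancel]
    have : (c + 1) * (c + 1) = c * (c + 1 + 1) + 1 := by ring
    omega
  obtain ⟨p, -, hp⟩ := (Nat.dvd_prime_pow Nat.prime_two).1 (Dvd.intro _ hfac)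
  obtain ⟨q, -, hq⟩ := (Nat.dvd_prime_pow Nat.prime_two).1 (Dvd.intro_left _ hfac)
  have hpq : 2 ^ q = 2 ^ p + 2 := by omega
  obtain ⟨hp1, hq2⟩ := sw_two_pow_eq_two_pow_add_two hpq
  subst hp1 hq2
  have hb3 : b = 3 := by omega
  subst hb3
  have h8 : 2 ^ d = 2 ^ 3 := by omega
  exact Nat.pow_right_injective (le_refl 2) h8

/-- The odd part of a perfect square is a perfect square: `t² = 2^e · c` with `c` odd ⇒ `c = b²` for some `b`. [folklore] -/
theorem sw_odd_part_sq {t e c : ℕ} (hc : Odd c) (h : t * t = 2 ^ e * c) : ∃ b, b * b = c := by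
  have ht : t ≠ 0 := by
    rintro rfl
    rw [zero_mul, eq_comm, mul_eq_zero] at h
    rcases h with h | h
    · exact pow_ne_zero _ two_ne_zero h
    · rw [h] at hc; exact (by decide : ¬ Odd 0) hc
  obtain ⟨a, b, hb, rfl⟩ := Nat.exists_eq_two_pow_mul_odd ht
  have h2 : 2 ^ (2 * a) * (b * b) = 2 ^ e * c := by rw [← h]; ring
  rcases Nat.lt_trichotomy (2 * a) e with hlt | heq | hgt
  · exfalso
    obtain ⟨r, hr⟩ : ∃ r, e = 2 * a + (r + 1) := ⟨e - 2 * a - 1, by omega⟩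
    rw [hr, pow_add] at h2
    have h3 : b * b = 2 ^ (r + 1) * c := by
      have h0 : 2 ^ (2 * a) ≠ 0 := pow_ne_zero _ two_ne_zero
      apply Nat.eq_of_mul_eq_mul_left (Nat.pos_of_ne_zero h0)
      rw [h2]; ring
    have heven : Even (b * b) := ⟨2 ^ r * c, by rw [h3, pow_succ]; ring⟩
    have hbe : Even b := by simpa [Nat.even_mul] using heven
    exact (Nat.not_even_iff_odd.2 hb) hbe
  · refine ⟨b, ?_⟩
    rw [heq] at h2
    exact Nat.eq_of_mul_eq_mul_left (Nat.pos_of_ne_zero (pow_ne_zero _ two_ne_zero)) h2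
  · exfalso
    obtain ⟨r, hr⟩ : ∃ r, 2 * a = e + (r + 1) := ⟨2 * a - e - 1, by omega⟩
    rw [hr, pow_add] at h2
    have h3 : c = 2 ^ (r + 1) * (b * b) := by
      have h0 : 2 ^ e ≠ 0 := pow_ne_zero _ two_ne_zero
      apply Nat.eq_of_mul_eq_mul_left (Nat.pos_of_ne_zero h0)
      rw [← h2]; ring
    have heven : Even c := ⟨2 ^ r * (b * b), by rw [h3, pow_succ]; ring⟩
    exact (Nat.not_even_iff_odd.2 hc) heven

/-! ### Derivative weights, periods and the double count (general `e`) -/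

/-- An xor-closed set containing `0ⁿ` has `2^j` elements (`j ≤ m`): it tiles the whole cube by its translates (`stub_invariantWeight`
applied to the constant function), so `#V ∣ 2^m`. [folklore] -/
theorem sw_card_xorClosed (V : Finset (Fin m → Bool)) (h0 : zeroVec ∈ V) (hV : ∀ x ∈ V, ∀ y ∈ V, bxor x y ∈ V) :
    ∃ j ≤ m, #V = 2 ^ j := by
  have hdvd : #V ∣ 2 ^ m := by
    have h := stub_invariantWeight m (fun _ => true) V h0 hV (fun _ _ _ => rfl)
    rwa [filter_true_of_mem (fun _ _ => rfl), card_univ, Fintype.card_fun, Fintype.card_bool, Fintype.card_fin] at h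
  exact (Nat.dvd_prime_pow Nat.prime_two).1 hdvd

/-- The weight of a derivative is at most twice the weight: `#{x : e x ≠ e(x ⊕ a)} ≤ 2·#{e = 1}`. [folklore] -/
theorem sw_deriv_card_le (e : (Fin m → Bool) → Bool) (a : Fin m → Bool) :
    #(univ.filter fun x => (e x ^^ e (bxor x a)) = true) ≤ 2 * #(univ.filter fun x => e x = true) := by
  calc #(univ.filter fun x => (e x ^^ e (bxor x a)) = true)
      ≤ #((univ.filter fun x => e x = true) ∪ univ.filter fun x => e (bxor x a) = true) := by
        refine card_le_card fun x hx => ?_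
        have h' := (mem_filter.1 hx).2
        rw [mem_union, mem_filter, mem_filter]
        revert h'; cases e x <;> cases e (bxor x a) <;> simp
    _ ≤ #(univ.filter fun x => e x = true) + #(univ.filter fun x => e (bxor x a) = true) := card_union_le _ _
    _ = #(univ.filter fun x => e x = true) + #(univ.filter fun x => e x = true) := by
        congr 1
        refine card_nbij' (fun x => bxor x a) (fun x => bxor x a) (fun x hx => ?_) (fun x hx => ?_)
          (fun x _ => by show bxor (bxor x a) a = x; rw [iw_bxor_assoc, BuzetChailloux.bxor_self, bxor_zeroVec])
          (fun x _ => by show bxor (bxor x a) a = x; rw [iw_bxor_assoc, BuzetChailloux.bxor_self, bxor_zeroVec])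
        · exact mem_filter.2 ⟨mem_univ _, (mem_filter.1 hx).2⟩
        · refine mem_filter.2 ⟨mem_univ _, ?_⟩
          rw [iw_bxor_assoc, BuzetChailloux.bxor_self, bxor_zeroVec]; exact (mem_filter.1 hx).2
    _ = 2 * #(univ.filter fun x => e x = true) := by ring

/-- **Double counting of derivative weights**: `Σ_a #{x : e x ≠ e(x ⊕ a)} = 2·#S·(2^m − #S)`, `S = {e = 1}`. [folklore] -/
theorem sw_sum_deriv_card (e : (Fin m → Bool) → Bool) :
    ∑ a, (#(univ.filter fun x => (e x ^^ e (bxor x a)) = true) : ℕ) =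
      2 * #(univ.filter fun x => e x = true) * (2 ^ m - #(univ.filter fun x => e x = true)) := by
  set S := univ.filter (fun x => e x = true) with hSdef
  have hM : #(univ : Finset (Fin m → Bool)) = 2 ^ m := by
    rw [card_univ, Fintype.card_fun, Fintype.card_bool, Fintype.card_fin]
  have hSc : #(univ.filter fun x : Fin m → Bool => ¬ e x = true) = 2 ^ m - #S := by
    have h := card_filter_add_card_filter_not (s := (univ : Finset (Fin m → Bool))) (fun x => e x = true)
    rw [hM] at h
    have h' : #S + #(univ.filter fun x : Fin m → Bool => ¬ e x = true) = 2 ^ m := h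
    omega
  simp_rw [card_filter]
  rw [sum_comm]
  have inner : ∀ x, ∑ a, (if (e x ^^ e (bxor x a)) = true then 1 else 0 : ℕ) =
      if e x = true then 2 ^ m - #S else #S := by
    intro x
    rw [Fintype.sum_equiv (Equiv.mk (bxor x) (bxor x) (bxor_bxor_cancel_left x) (bxor_bxor_cancel_left x))
      (fun a => if (e x ^^ e (bxor x a)) = true then 1 else 0) (fun y => if (e x ^^ e y) = true then 1 else 0) (fun _ => rfl)]
    rw [sum_boole]
    cases hx : e x
    · simp only [Bool.false_xor, Bool.false_eq_true, if_false, Nat.cast_id]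
      rfl
    · simp only [Bool.true_xor, if_true, Bool.not_eq_true', Nat.cast_id]
      have hc' : (univ.filter fun y : Fin m → Bool => ¬ e y = true) = univ.filter fun y => e y = false :=
        filter_congr fun y _ => by cases e y <;> simp
      rw [← hc']; exact hSc
  rw [sum_congr rfl fun x _ => inner x, sum_ite, sum_const, sum_const, smul_eq_mul, smul_eq_mul]
  rw [show (univ.filter fun x : Fin m → Bool => e x = true) = S from rfl, hSc]
  ring

/-- Membership in the periods `V₀ = {a : e(· ⊕ a) = e}` is the vanishing of the derivative weight. [folklore] -/
theorem sw_mem_periods_iff (e : (Fin m → Bool) → Bool) (a : Fin m → Bool) :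
    a ∈ (univ.filter fun a : Fin m → Bool => ∀ x, e (bxor x a) = e x) ↔
      #(univ.filter fun x => (e x ^^ e (bxor x a)) = true) = 0 := by
  rw [card_eq_zero, filter_eq_empty_iff]
  constructor
  · intro ha x _; rw [(mem_filter.1 ha).2 x, Bool.xor_self]; exact Bool.false_ne_true
  · intro h0'; refine mem_filter.2 ⟨mem_univ _, fun x => ?_⟩
    have := h0' (mem_univ x); revert this; cases e x <;> cases e (bxor x a) <;> simp

/-- The periods form an xor-closed set containing `0ⁿ`, hence of cardinality `2^j`. [folklore] -/
theorem sw_card_periods (e : (Fin m → Bool) → Bool) :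
    ∃ j ≤ m, #(univ.filter fun a : Fin m → Bool => ∀ x, e (bxor x a) = e x) = 2 ^ j := by
  refine sw_card_xorClosed _ (mem_filter.2 ⟨mem_univ _, fun x => by rw [bxor_zeroVec]⟩) fun a ha b hb => ?_
  refine mem_filter.2 ⟨mem_univ _, fun x => ?_⟩
  rw [← iw_bxor_assoc, (mem_filter.1 hb).2, (mem_filter.1 ha).2]

/-- **Master count.** If every derivative weight is `0` or the constant `K`, then `2·#S·(2^m − #S) = K·(2^m − 2^j)` where `2^j ≤ 2^m`
is the number of periods. [folklore] -/
theorem sw_master (e : (Fin m → Bool) → Bool) (K : ℕ)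
    (hK : ∀ a, #(univ.filter fun x => (e x ^^ e (bxor x a)) = true) = 0 ∨ #(univ.filter fun x => (e x ^^ e (bxor x a)) = true) = K) :
    ∃ j ≤ m, 2 * #(univ.filter fun x => e x = true) * (2 ^ m - #(univ.filter fun x => e x = true)) = K * (2 ^ m - 2 ^ j) := by
  classical
  obtain ⟨j, hj, hcard⟩ := sw_card_periods e
  refine ⟨j, hj, ?_⟩
  have hM : #(univ : Finset (Fin m → Bool)) = 2 ^ m := by
    rw [card_univ, Fintype.card_fun, Fintype.card_bool, Fintype.card_fin]
  have h2 := card_filter_add_card_filter_not (s := (univ : Finset (Fin m → Bool)))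
    (fun a => a ∈ (univ.filter fun a : Fin m → Bool => ∀ x, e (bxor x a) = e x))
  rw [filter_mem_eq_inter, univ_inter, hM, hcard] at h2
  have hF : #(univ.filter fun a : Fin m → Bool => ¬ a ∈ (univ.filter fun a : Fin m → Bool => ∀ x, e (bxor x a) = e x)) =
      2 ^ m - 2 ^ j := Nat.eq_sub_of_add_eq (by rw [add_comm] at h2; exact h2)
  rw [← sw_sum_deriv_card e, ← sum_filter_add_sum_filter_not univ
    (fun a => a ∈ (univ.filter fun a : Fin m → Bool => ∀ x, e (bxor x a) = e x))]
  rw [sum_eq_zero fun a ha => (sw_mem_periods_iff e a).1 (mem_filter.1 ha).2, zero_add]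
  rw [sum_congr rfl fun a ha => ((hK a).resolve_left fun h => absurd ((sw_mem_periods_iff e a).2 h) (mem_filter.1 ha).2),
    sum_const, smul_eq_mul, hF, mul_comm]

/-! ### Affine derivatives: weight `0`, `2^{m-1}` or `2^m` -/

/-- An affine Boolean function (degree `≤ 1`) is `≡ 0`, `≡ 1`, or balanced: `#{h = 1} = 0`, `= 2^m`, or `2·#{h = 1} = 2^m`.
[cite: Carlet2020, §2.2] -/
theorem sw_affine_card (h : (Fin m → Bool) → Bool) (hh : IsDegLeFun 1 h) :
    #(univ.filter fun x => h x = true) = 0 ∨ #(univ.filter fun x => h x = true) = 2 ^ m ∨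
      2 * #(univ.filter fun x => h x = true) = 2 ^ m := by
  have hM : #(univ : Finset (Fin m → Bool)) = 2 ^ m := by
    rw [card_univ, Fintype.card_fun, Fintype.card_bool, Fintype.card_fin]
  rcases qb_affine_dichotomy hh with hc | hb
  · cases h0 : h zeroVec
    · left
      rw [card_eq_zero, filter_eq_empty_iff]
      intro x _; rw [hc x, h0]; exact Bool.false_ne_true
    · right; left
      rw [filter_true_of_mem fun x _ => by rw [hc x, h0], hM]
  · right; right
    have hs := bb_sum_signOf (fun _ : Fin m → Bool => True) h
    rw [filter_true_of_mem (fun _ _ => trivial), hb, hM] at hs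
    have e : (univ.filter fun y : Fin m → Bool => True ∧ h y = true) = univ.filter fun x => h x = true :=
      filter_congr fun x _ => by simp
    rw [e] at hs
    have hs' : (2 : ℝ) * #(univ.filter fun x : Fin m → Bool => h x = true) = ((2 ^ m : ℕ) : ℝ) := by linarith
    exact_mod_cast hs'

/-! ### The second weight of `RM(2,m)` -/

/-- **No quadratic weight in `(2^{m-2}, 3·2^{m-3})`.**  A non-zero Boolean function `q` of degree `≤ 2` on `m` bits with
`8·#{q = 1} < 3·2^m` has `4·#{q = 1} = 2^m` exactly (the minimum weight). [cite: KasamiTokura1970, Thm 1] [cite: MacWilliamsSloane1977, Ch. 15 §3] -/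
theorem sw_quadratic_second_weight (q : (Fin m → Bool) → Bool) (hq : IsDegLeFun 2 q) (hne : ∃ x, q x = true)
    (hlt : 8 * #(univ.filter fun x => q x = true) < 3 * 2 ^ m) :
    4 * #(univ.filter fun x => q x = true) = 2 ^ m := by
  classical
  have hSpos : 0 < #(univ.filter fun x => q x = true) := by
    obtain ⟨x, hx⟩ := hne
    exact card_pos.2 ⟨x, mem_filter.2 ⟨mem_univ _, hx⟩⟩
  -- `m ≥ 2`
  obtain ⟨k, rfl⟩ : ∃ k, m = k + 2 := by
    rcases Nat.lt_or_ge m 2 with hm | hm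
    · exfalso; interval_cases m <;> simp only [pow_zero, pow_one] at hlt <;> omega
    · exact ⟨m - 2, by omega⟩
  have hN : 2 ^ (k + 2) = 4 * 2 ^ k := by ring
  -- every derivative has weight `0` or `2^{k+1}`
  have hK : ∀ a, #(univ.filter fun x => (q x ^^ q (bxor x a)) = true) = 0 ∨
      #(univ.filter fun x => (q x ^^ q (bxor x a)) = true) = 2 ^ (k + 1) := by
    intro a
    have hdeg : IsDegLeFun 1 (fun x => q x ^^ q (bxor x a)) := stub_derivDegree (k + 2) 1 q a hq
    have hle := sw_deriv_card_le q a
    have h2k : 2 ^ (k + 1) = 2 * 2 ^ k := by ring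
    rcases sw_affine_card _ hdeg with h0 | hfull | hhalf
    · exact Or.inl h0
    · exfalso
      rw [hfull] at hle
      omega
    · right
      omega
  obtain ⟨j, hj, hmaster⟩ := sw_master q (2 ^ (k + 1)) hK
  -- `t := 2^m − 2#S` satisfies `t² = 2^{m+j}`
  obtain ⟨t, ht⟩ : ∃ t, t + 2 * #(univ.filter fun x => q x = true) = 2 ^ (k + 2) :=
    ⟨2 ^ (k + 2) - 2 * #(univ.filter fun x => q x = true), by omega⟩
  have hjle : 2 ^ j ≤ 2 ^ (k + 2) := Nat.pow_le_pow_right (by norm_num) hj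
  have htsq : t * t = 2 ^ (k + 2 + j) := by
    have hs : #(univ.filter fun x => q x = true) ≤ 2 ^ (k + 2) := by omega
    zify [hjle, hs] at hmaster ht ⊢
    have ht' : (t : ℤ) = 2 ^ (k + 2) - 2 * (#(univ.filter fun x => q x = true) : ℤ) := by linarith
    rw [ht', pow_add]
    linear_combination (-2 : ℤ) * hmaster
  obtain ⟨i, -, hi⟩ := (Nat.dvd_prime_pow Nat.prime_two).1 (Dvd.intro _ htsq : t ∣ 2 ^ (k + 2 + j))
  -- `2^k < t ≤ 2^{k+2}`, so `t ∈ {2^{k+1}, 2^{k+2}}`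
  have htgt : 2 ^ k < t := by omega
  have htle : t ≤ 2 ^ (k + 2) := by omega
  rw [hi] at htgt htle
  have hik : k < i := (Nat.pow_lt_pow_iff_right (by norm_num : 1 < 2)).1 htgt
  have hik' : i ≤ k + 2 := (Nat.pow_le_pow_iff_right (by norm_num : 1 < 2)).1 htle
  have h2k : 2 ^ (k + 1) = 2 * 2 ^ k := by ring
  rcases (show i = k + 1 ∨ i = k + 2 by omega) with rfl | rfl
  · omega
  · exfalso
    omega

/-! ### The second weight of `RM(3,m)` -/

/-- **No cubic weight in `(2^{m-3}, 3·2^{m-4})`.**  A non-zero Boolean function `c` of degree `≤ 3` on `m` bits with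
`16·#{c = 1} < 3·2^m` has `8·#{c = 1} = 2^m` exactly (the minimum weight; then `{c = 1}` is an `(m−3)`-flat by
`mw_flat_of_minweight`). [cite: KasamiTokura1970, Thm 1] [cite: MacWilliamsSloane1977, Ch. 15 §3] -/
theorem sw_cubic_second_weight (c : (Fin m → Bool) → Bool) (hc : IsDegLeFun 3 c) (hne : ∃ x, c x = true)
    (hlt : 16 * #(univ.filter fun x => c x = true) < 3 * 2 ^ m) :
    8 * #(univ.filter fun x => c x = true) = 2 ^ m := by
  classical
  have hSpos : 0 < #(univ.filter fun x => c x = true) := by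
    obtain ⟨x, hx⟩ := hne
    exact card_pos.2 ⟨x, mem_filter.2 ⟨mem_univ _, hx⟩⟩
  -- `m ≥ 3`
  obtain ⟨k, rfl⟩ : ∃ k, m = k + 3 := by
    rcases Nat.lt_or_ge m 3 with hm | hm
    · exfalso; interval_cases m <;> simp only [pow_zero, pow_one, Nat.reducePow] at hlt <;> omega
    · exact ⟨m - 3, by omega⟩
  have hN : 2 ^ (k + 3) = 8 * 2 ^ k := by ring
  -- every derivative has weight `0` or `2^{k+1}`
  have hK : ∀ a, #(univ.filter fun x => (c x ^^ c (bxor x a)) = true) = 0 ∨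
      #(univ.filter fun x => (c x ^^ c (bxor x a)) = true) = 2 ^ (k + 1) := by
    intro a
    have hdeg : IsDegLeFun 2 (fun x => c x ^^ c (bxor x a)) := stub_derivDegree (k + 3) 2 c a hc
    have hle := sw_deriv_card_le c a
    by_cases hz : #(univ.filter fun x => (c x ^^ c (bxor x a)) = true) = 0
    · exact Or.inl hz
    · right
      obtain ⟨x, hx⟩ : ∃ x, (c x ^^ c (bxor x a)) = true := by
        by_contra hno
        push Not at hno
        exact hz (card_eq_zero.2 (filter_eq_empty_iff.2 fun x _ => hno x))
      have h8 : 8 * #(univ.filter fun x => (c x ^^ c (bxor x a)) = true) < 3 * 2 ^ (k + 3) := by omega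
      have h4 := sw_quadratic_second_weight _ hdeg ⟨x, hx⟩ h8
      have h2k : 2 ^ (k + 1) = 2 * 2 ^ k := by ring
      omega
  obtain ⟨j, hj, hmaster⟩ := sw_master c (2 ^ (k + 1)) hK
  -- `t := 2^{m+1} − 4#S` satisfies `t² = 2^{m+1}(2^m + 2^j)`
  obtain ⟨t, ht⟩ : ∃ t, t + 4 * #(univ.filter fun x => c x = true) = 2 * 2 ^ (k + 3) :=
    ⟨2 * 2 ^ (k + 3) - 4 * #(univ.filter fun x => c x = true), by omega⟩
  have hjle : 2 ^ j ≤ 2 ^ (k + 3) := Nat.pow_le_pow_right (by norm_num) hj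
  have htsq : t * t = 2 ^ (k + 4) * (2 ^ (k + 3) + 2 ^ j) := by
    have hs : #(univ.filter fun x => c x = true) ≤ 2 ^ (k + 3) := by omega
    zify [hjle, hs] at hmaster ht ⊢
    have ht' : (t : ℤ) = 2 * 2 ^ (k + 3) - 4 * (#(univ.filter fun x => c x = true) : ℤ) := by linarith
    rw [ht']
    linear_combination (-8 : ℤ) * hmaster
  rcases Nat.lt_or_ge j (k + 3) with hjlt | hjge
  · -- `j < m`: the odd part `2^{m-j} + 1` of `t²` is a square, so `m − j = 3`
    obtain ⟨d, hd⟩ : ∃ d, k + 3 = j + (d + 1) := ⟨k + 3 - j - 1, by omega⟩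
    have htsq' : t * t = 2 ^ (k + 4 + j) * (2 ^ (d + 1) + 1) := by
      rw [htsq, hd, pow_add, pow_add]; ring
    obtain ⟨b, hb⟩ := sw_odd_part_sq ⟨2 ^ d, by rw [pow_succ]; ring⟩ htsq'
    have hd3 : d + 1 = 3 := sw_sq_eq_two_pow_add_one hb
    have hjk : j = k := by omega
    subst hjk
    -- `t² = 9·2^{2j+4}`, so `t = 3·2^{j+2}` and `4#S = 2^{j+2}`
    have htsq3 : t * t = (3 * 2 ^ (j + 2)) * (3 * 2 ^ (j + 2)) := by
      rw [htsq]; ring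
    have ht3 : t = 3 * 2 ^ (j + 2) := Nat.mul_self_inj.1 htsq3
    have h4 : 2 ^ (j + 2) = 4 * 2 ^ j := by ring
    omega
  · -- `j = m`: `t = 2^{m+1}`, `#S = 0`
    exfalso
    have hjm : j = k + 3 := le_antisymm hj hjge
    subst hjm
    have htsq2 : t * t = (2 * 2 ^ (k + 3)) * (2 * 2 ^ (k + 3)) := by rw [htsq]; ring
    have ht2 : t = 2 * 2 ^ (k + 3) := Nat.mul_self_inj.1 htsq2
    omega

end Summit.QuantumAdvantage.QuantumAdvantage.Theorems.CubicForrelation.NearExactIsExact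

end
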